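import Literature.Geometry.Riemannian.ConformallyCompactFilling
import Literature.Geometry.Riemannian.RoundSphere
import Literature.Geometry.Riemannian.RiemannianDistance
import Literature.Topology.FourManifolds.InteriorSmoothEmbedding
import Literature.Topology.FourManifolds.SmoothEmbeddingComp
import Mathlib.Geometry.Manifold.Diffeomorph

/-!
# Crux `PEFillNearRound` (stmt-SmoothPoincare4-7997), line `Sketch`, helper piece `helper_rfg_transport` of
# RoundFilled-general (= the registered `stub_roundFilled` of item stmt-SmoothPoincare4-18033
# `PEFillStandardSphere`: a round metric on ANY closed 4-manifold diffeomorphic to `S⁴` is the conformal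
# infinity of a Poincaré–Einstein 5-manifold — hyperbolic 5-space transported along the Killing–Hopf isometry)

Transport of a Poincaré–Einstein filling package (`Literature.Geometry.Riemannian.IsPoincareEinsteinFilling`,
the nine-conjunct package of the route items with `Ric = -4g`) along an isometric diffeomorphism of the
boundary: if `(T, g₀)` bounds `(N, g⁺)` with compactification `(X̄, j, ι, ρ, ḡ)` and `Φ : T → M` is a
diffeomorphism with `h(dΦ X, dΦ Y) = g₀(X, Y)`, then `(M, h)` bounds the same `(N, g⁺)` with the same
compactification and `ι' = ι ∘ Φ⁻¹` (conformal factor `φ ∘ Φ⁻¹`). Pure bookkeeping.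
-/

noncomputable section

-- the prescribed namespace `Summit.<P>.<Sub>.…` duplicates `SmoothPoincare4` (P = Sub)
set_option linter.dupNamespace false

open scoped Manifold ContDiff Topology
open Set Function Bundle
open Literature.Geometry.Lorentzian Literature.Geometry.Lorentzian.PseudoRiemannianMetric
open Literature.Geometry.Riemannian

namespace Summit.SmoothPoincare4.SmoothPoincare4.Cruxes.PEFillNearRound.RoundFilled

/-- **A Poincaré–Einstein filling of `(T, g₀)` is a Poincaré–Einstein filling of any `(M, h)` isometric to
it**: re-parametrise the boundary embedding by the isometry (`ι' = ι ∘ Φ⁻¹`); bulk, compactification,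
defining function and compactified metric are unchanged. [folklore] -/
theorem helper_rfg_transport :
    ∀ (T : Type) [TopologicalSpace T] [ChartedSpace (EuclideanSpace ℝ (Fin 4)) T] [IsManifold (𝓡 4) ∞ T] (g₀ : Bundle.ContMDiffRiemannianMetric (𝓡 4) ∞ (EuclideanSpace ℝ (Fin 4)) (TangentSpace (𝓡 4) : T → Type _)) (M : Type) [TopologicalSpace M] [ChartedSpace (EuclideanSpace ℝ (Fin 4)) M] [IsManifold (𝓡 4) ∞ M] (h : Bundle.ContMDiffRiemannianMetric (𝓡 4) ∞ (EuclideanSpace ℝ (Fin 4)) (TangentSpace (𝓡 4) : M → Type _)) (Φ : T ≃ₘ⟮𝓡 4, 𝓡 4⟯ M), (∀ (x : T) (X Y : TangentSpace (𝓡 4) x), h.inner (Φ x) (mfderiv (𝓡 4) (𝓡 4) Φ x X) (mfderiv (𝓡 4) (𝓡 4) Φ x Y) = g₀.inner x X Y) → (∃ (N : Type) (_ : TopologicalSpace N) (_ : T2Space N) (_ : SecondCountableTopology N) (_ : ChartedSpace (EuclideanSpace ℝ (Fin 5)) N) (_ : IsManifold (𝓡 5) ∞ N) (g : Bundle.ContMDiffRiemannianMetric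 (𝓡 5) ∞ (EuclideanSpace ℝ (Fin 5)) (TangentSpace (𝓡 5) : N → Type _)) (_ : (Literature.Geometry.Lorentzian.PseudoRiemannianMetric.ofRiemannian g).HasLeviCivita), Literature.Geometry.Riemannian.IsPoincareEinsteinFilling T g₀ N g) → (∃ (N : Type) (_ : TopologicalSpace N) (_ : T2Space N) (_ : SecondCountableTopology N) (_ : ChartedSpace (EuclideanSpace ℝ (Fin 5)) N) (_ : IsManifold (𝓡 5) ∞ N) (g : Bundle.ContMDiffRiemannianMetric (𝓡 5) ∞ (EuclideanSpace ℝ (Fin 5)) (TangentSpace (𝓡 5) : N → Type _)) (_ : (Literature.Geometry.Lorentzian.PseudoRiemannianMetric.ofRiemannian g).HasLeviCivita), Literature.Geometry.Riemannian.IsPoincareEinsteinFilling M h N g) := by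
  intro T _ _ _ g₀ M _ _ _ h Φ hiso hfill
  obtain ⟨N, _, _, _, _, _, g, _, hRic, X, _, _, _, _, _, _, _, j, ι, ρ, gb, hj, hjr, hι, hιr, hρ,
    hρ0, hρb, hν, hconf, φ, hφ⟩ := hfill
  -- chain rule on `Φ ∘ Φ⁻¹ = id`: `dΦ ∘ dΦ⁻¹ = id`
  have hkey : ∀ (y : M) (v : TangentSpace (𝓡 4) y),
      mfderiv (𝓡 4) (𝓡 4) Φ (Φ.symm y) (mfderiv (𝓡 4) (𝓡 4) Φ.symm y v) = v := by
    intro y v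
    have h1 : HasMFDerivAt (𝓡 4) (𝓡 4) (Φ ∘ Φ.symm) y
        ((mfderiv (𝓡 4) (𝓡 4) Φ (Φ.symm y)).comp (mfderiv (𝓡 4) (𝓡 4) Φ.symm y)) :=
      HasMFDerivAt.comp y (Φ.mdifferentiable (by simp) _).hasMFDerivAt
        (Φ.symm.mdifferentiable (by simp) _).hasMFDerivAt
    have h2 : HasMFDerivAt (𝓡 4) (𝓡 4) (Φ ∘ Φ.symm) y
        (ContinuousLinearMap.id ℝ (TangentSpace (𝓡 4) y)) :=
      (hasMFDerivAt_id y).congr_of_eventuallyEq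
        (Filter.Eventually.of_forall fun z => Φ.apply_symm_apply z)
    exact DFunLike.congr_fun (hasMFDerivAt_unique h1 h2) v
  -- transport of `h.inner` along an equality of base points (the fibres are all `ℝ⁴`)
  have hpt : ∀ {a b : M}, a = b → ∀ (v w : EuclideanSpace ℝ (Fin 4)),
      h.inner a v w = h.inner b v w := by
    intro a b e v w
    subst e
    rfl
  -- the isometry hypothesis in pulled-back form `h = (Φ⁻¹)^* g₀`
  have hiso' : ∀ (y : M) (v w : TangentSpace (𝓡 4) y),
      g₀.inner (Φ.symm y) (mfderiv (𝓡 4) (𝓡 4) Φ.symm y v) (mfderiv (𝓡 4) (𝓡 4) Φ.symm y w) =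
        h.inner y v w := by
    intro y v w
    rw [← hiso (Φ.symm y), hkey, hkey]
    exact hpt (Φ.apply_symm_apply y) v w
  -- (3') the new boundary embedding `ι ∘ Φ⁻¹`
  have hsrc : Φ.symm.toHomeomorph.toOpenPartialHomeomorph.source = univ := rfl
  have hemb : Manifold.IsSmoothEmbedding (𝓡 4) (𝓡∂ 5) ∞ (ι ∘ Φ.symm) :=
    hι.comp_openPartialHomeomorph Φ.symm.toHomeomorph.toOpenPartialHomeomorph hsrc
      Φ.symm.contMDiff.contMDiffOn Φ.contMDiff.contMDiffOn
  -- (4') same range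
  have hrange : range (ι ∘ Φ.symm) = (𝓡∂ 5).boundary X := by
    rw [(EquivLike.surjective Φ.symm).range_comp]
    exact hιr
  -- (9b') chain rule for `ι ∘ Φ⁻¹`, then the old (9b) at `Φ⁻¹ y` and the isometry
  have hmd : ∀ (y : M) (v : TangentSpace (𝓡 4) y),
      mfderiv (𝓡 4) (𝓡∂ 5) (ι ∘ Φ.symm) y v =
        mfderiv (𝓡 4) (𝓡∂ 5) ι (Φ.symm y) (mfderiv (𝓡 4) (𝓡 4) Φ.symm y v) := by
    intro y v
    rw [mfderiv_comp y (hι.contMDiff.mdifferentiableAt (by simp))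
      (Φ.symm.mdifferentiable (by simp) y)]
    rfl
  have hfin : ∀ (y : M) (v w : TangentSpace (𝓡 4) y),
      gb.inner (ι (Φ.symm y)) (mfderiv (𝓡 4) (𝓡∂ 5) (ι ∘ Φ.symm) y v)
        (mfderiv (𝓡 4) (𝓡∂ 5) (ι ∘ Φ.symm) y w) = φ (Φ.symm y) * h.inner y v w := by
    intro y v w
    rw [hmd, hmd, (hφ (Φ.symm y)).2, hiso']
  exact ⟨N, inferInstance, inferInstance, inferInstance, inferInstance, inferInstance, g,
    inferInstance, hRic, X, inferInstance, inferInstance, inferInstance, inferInstance,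
    inferInstance, inferInstance, inferInstance, j, ι ∘ Φ.symm, ρ, gb, hj, hjr, hemb, hrange, hρ,
    hρ0, hρb, fun y => hν (Φ.symm y), hconf, fun y => φ (Φ.symm y),
    fun y => ⟨(hφ (Φ.symm y)).1, hfin y⟩⟩

end Summit.SmoothPoincare4.SmoothPoincare4.Cruxes.PEFillNearRound.RoundFilled

end
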